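import Summits.BirchSwinnertonDyer.BirchSwinnertonDyer.Theorems.ThetaPartnerAtTwoSignedMainConjectureCMTwoRankZeroKatoDescentSocketDefs
import Summits.BirchSwinnertonDyer.BirchSwinnertonDyer.Theorems.ThetaPartnerAtTwoSignedMainConjectureCMTwoRankZeroKatoDescentTransport
import HarnessLib

/-!
# Kato's descent — file 6b: clause (g)^ι FROM the transport socket (structure `CycTransportSocket`, file 6a `…KatoDescentSocketDefs.lean`). Clause (g)^ι of 26471's registered stub `stub_coreLowerCMTwo`
# from ONE hypothesis structure = Kato Lemma 15.13 (1)/(15.13.1)/(15.13.2) + (15.16.1) + §15.15 relative to the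
# pinned K-side tower `D : Kato2004.EllipticUnitTower` and the pinned ℚ-side `𝐇¹_Γ(T₂A)`, `X₀(A/ℚ_∞)`

Helper file for crux K2R0P♭ `stmt-BirchSwinnertonDyer-26471`
(`Summit.BirchSwinnertonDyer.BirchSwinnertonDyer.Theses.ThetaPartnerAtTwo.SignedMainConjectureCMTwoRankZeroOfPubOfFlat`,
route `ThetaPartnerAtTwo`, line `rankzero` v17 — ONE registered stub `stub_coreLowerCMTwo` = (CORE♭-lower), whose last conjunct is
(g)^ι `lengthAt Λ (I.H ⧸ Λ∙s) 𝔭′ ≤ lengthAt Λ Y.X (ι𝔭′)`; lead prover bsd-wall-tp2-p2 g9, 2026-08-28). BSD is not proved by any of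
this; nothing is asserted (the structure below is a HYPOTHESIS structure — a socket —, the theorem an implication).

WHY A SOCKET. Files 1–5 of this series proved every piece of ALGEBRA between the printed K-tower equality (Johnson-Leung–Kings 2011
Thm. 5.7 / §7.2, typed: `ZetaSkeleton.Thm57RegularShape` on `D.toZetaSkeleton`, transported to `A = Λ_𝔮` by the typer's
`thm57RegularShape_lengthAt_atPrime_eq_of_not_mem`) and clause (g)^ι: Kato's Lemma 14.15 (file 2), the descent inequality and its K-side
composition (files 3–4), the ℚ-side Thm. 12.4 (2) discharge and the length adapters (file 5). What is NOT in the tree is Kato's Lemma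
15.13 itself — the comparison between the K-tower modules localised at `𝔮 = π⁻¹𝔭′` and Kato's cyclotomic `𝐇^q(T~)_{𝔭′}` — nor (15.16.1)
(the elliptic zeta element maps to Kato's zeta element of `f_A`) nor the Poitou–Tate reading `𝐇²(T~) ↔ X₀`: these need carriers the tree
does not have (corestriction along `ℚ_n ⊂ K(ζ_{2^{n+2}}) ⊂ K(2^{n+2}𝔣)`, the `ψ`-twist, an `O_K`-action on `T₂A`; typer design
bsd-inputs-er2-ty1 evidence #26 §B on 24945, recommended unit «CyclotomicTransport»). `CycTransportSocket` lists EXACTLY the statements such a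
unit must deliver, as fields RELATIVE TO the pinned objects (`D`, `I : Kato2004.IwasawaH1Data A 2 κ γ`, `Y : A.FineSelmerDualData κ γ`, a
class `s ∈ 𝐇¹_Γ(T₂A)`), in the currency consumed by files 3–5; and `lengthAt_quotient_span_le_of_cycTransportSocket` PROVES that any
inhabitant yields (g)^ι for `(I, Y, s, 𝔭′)`. Field ↔ print: `isNoetherianRing/isDomain/krullDimLE/height_ne_one/a/a_mem/φ/φ_surjective/
ker_φ` = Lemma 15.13 (1) ("`O_λ⟦G_{p^∞𝔣}⟧_𝔮` and `O_λ⟦G_∞⟧_𝔭` are regular; the kernel … is a principal ideal `(a)`", with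
`A/aA ≅ O_λ⟦G_∞⟧_𝔭 → Λ_{𝔭′}` the `Δ`-projection reading, flag Kato-134-two-Delta of `Kato2004/EulerSystemBoundFineSelmerTwo`);
`torsH` = §15.1 ("`𝔥¹` is torsion free") at `𝔮`; `ι/ι_smul/ker_ι/length_coker_le` = (15.13.2) (`0 → H¹_𝔮/aH¹_𝔮 → 𝐇¹(T~)_𝔭 → H²_𝔮[a] → 0`);
`ι_ell/s_ne_zero` = (15.16.1) + §15.15 (the image of `z_{p^∞𝔣}` is Kato's zeta element, non-zero); `length_quot_le/length_quot_ne_top` =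
(15.13.1) (`H²_𝔮/aH²_𝔮 ≅ 𝐇²(T~)_𝔭`) read with Thm. 12.4 (1) (torsion ⟹ finite length) and the Poitou–Tate reading `𝐇²(T~)_{𝔭′} ↔ X₀_{ι𝔭′}`
off `(2)` (flag Kato-134-H20-fine; Thm. 12.5 (3): no local `𝐇²` term for `f` potentially good at `p`). HONEST LIMIT: the structure does
NOT express that `D` is the elliptic-unit tower of the CM field and conductor OF `A` (no Grössencharacter in the tree): it is a socket, to
be inhabited only by a faithful construction; an inhabitant for unrelated `(D, A)` would be junk — nothing here asserts one exists.

## References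
* K. Kato, Astérisque 295 (2004), §15.1 (p. 251), Thm. 12.4–12.5 (pp. 221–222), Lemma 14.15 (pp. 243–244), Lemma 15.13, §15.15,
  (15.16.1), Prop. 15.17 (pp. 264–265).
* J. Johnson-Leung, G. Kings, J. reine angew. Math. 653 (2011), Thm. 5.7, §7.2.
-/

set_option autoImplicit false
set_option linter.dupNamespace false

noncomputable section

open scoped Classical Pointwise NumberField

namespace Summit.BirchSwinnertonDyer.BirchSwinnertonDyer.Theorems.KatoDescent

open Literature.NumberTheory.EllipticCurves Literature.NumberTheory.EllipticCurves.Module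
  Literature.NumberTheory.EllipticCurves.Kato2004 Literature.NumberTheory.GaloisRepresentations Field
  Literature.NumberTheory.ComplexMultiplication.EllipticUnits
open Literature.NumberTheory.ComplexMultiplication.EllipticUnits.Kato2004 (EllipticUnitTower)

section Socket

variable {K : Type} [Field K] [NumberField K] {𝔣 : Ideal (𝓞 K)} {ι₀ : K →+* ℂ}
  {A : WeierstrassCurve ℚ} [A.IsElliptic] [ContinuousSMul ℤ_[2] (A.tateModule 2)]
  {κ : ZpExtension ℚ 2} {γ : absoluteGaloisGroup ℚ}

/-- **Clause (g)^ι from the transport socket, the K-tower equality (JLK 2011 §7.2) and Kato §15.1 — everything else is kernel.**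
For the pinned tower `D` with the printed clause `hreg`, Kato's `𝔥²`-module `H2` (finitely generated torsion), the EQUALITY
`Thm57RegularShape 2` on `D.toZetaSkeleton` (Johnson-Leung–Kings Thm. 5.7 at the regular primes), the §15.1 review `Section151Shape`, a
topological generator `γ` (Kato Thm. 12.4 (2) is then the tree theorem `IwasawaH1Data.isTorsionFree`), and ANY inhabitant of
`CycTransportSocket D 𝔮 𝔞 H2 I Y s 𝔭′`: **`lengthAt Λ (I.H ⧸ Λ∙s) 𝔭′ ≤ lengthAt Λ Y.X (ι𝔭′)`** — the conjunct (g)^ι of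
`stub_coreLowerCMTwo` (line `rankzero` v17) for `(I, Y, s, 𝔭′)`. Proof: the structure-free `lengthAt_quotient_span_le_of_transport` (file 6, `…KatoDescentTransport.lean`) applied to the fields.
[cite: Kato2004Asterisque, Lemma 15.13, Prop. 15.17, §15.15, (15.16.1) (pp. 264–265), Lemma 14.15 (pp. 243–244), Thm. 12.4 (p. 221)]
[cite: JohnsonLeungKings2011, Thm. 5.7 and §7.2] -/
theorem lengthAt_quotient_span_le_of_cycTransportSocket
    (D : EllipticUnitTower K 2 𝔣 ι₀)
    (hreg : ∀ 𝔞 : EllipticUnitTower.TwistIdeals K 2 𝔣, IsSMulRegular D.Λ (D.nsub 𝔞.1))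
    {H0 H2 : Type} [AddCommGroup H0] [Module D.Λ H0] [AddCommGroup H2] [Module D.Λ H2]
    [Module.Finite D.Λ H2] (hH2 : Module.IsTorsion D.Λ H2)
    (hK : (D.toZetaSkeleton hreg H0 H2).Thm57RegularShape 2)
    (h151 : D.Section151Shape) (hγ : κ.IsTopGenerator γ)
    {𝔮 : PrimeSpectrum D.Λ} {𝔞 : Ideal (𝓞 K)} {I : IwasawaH1Data A 2 κ γ} {Y : A.FineSelmerDualData κ γ} {s : I.H}
    {𝔭' : PrimeSpectrum (IwasawaAlgebra 2)} (T : CycTransportSocket D 𝔮 𝔞 H2 I Y s 𝔭') :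
    lengthAt (IwasawaAlgebra 2) (I.H ⧸ Submodule.span (IwasawaAlgebra 2) {s}) 𝔭' ≤
      lengthAt (IwasawaAlgebra 2) Y.X (PrimeSpectrum.comap (IwasawaAlgebra.invol 2).toRingHom 𝔭') := by
  haveI := T.isNoetherianRing
  haveI := T.isDomain
  haveI := T.krullDimLE
  exact lengthAt_quotient_span_le_of_transport D hreg hH2 hK h151 hγ T.two_not_mem T.isTwist T.nsub_not_mem
    T.height_ne_one T.a_mem T.φ T.φ_surjective T.ker_φ T.torsH T.ι T.ι_smul T.ker_ι T.length_coker_le T.ι_ell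
    T.s_ne_zero T.length_quot_le T.length_quot_ne_top


/-- **Clause (g)^ι of `stub_coreLowerCMTwo` from ONE K-side datum** (appended, lead g9): for a topological generator `γ` and ANY
`T : KSideDatum I Y s 𝔭′` (K-side tower + JLK §7.2 equality + §15.1 + transport socket, file 6a),
`lengthAt Λ (I.H ⧸ Λ∙s) 𝔭′ ≤ lengthAt Λ Y.X (ι𝔭′)`. This is the form the line `rankzero` v18 consumes: its stub replaces the
conjunct (g)^ι of (CORE♭-lower) by `Nonempty (KSideDatum I Y s 𝔭′)`.
[cite: Kato2004Asterisque, Lemma 15.13, Prop. 15.17, §15.15, (15.16.1) (pp. 264–265)] [cite: JohnsonLeungKings2011, Thm. 5.7 and §7.2] -/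
theorem lengthAt_quotient_span_le_of_kSideDatum (hγ : κ.IsTopGenerator γ)
    {I : IwasawaH1Data A 2 κ γ} {Y : A.FineSelmerDualData κ γ} {s : I.H} {𝔭' : PrimeSpectrum (IwasawaAlgebra 2)}
    (T : KSideDatum I Y s 𝔭') :
    lengthAt (IwasawaAlgebra 2) (I.H ⧸ Submodule.span (IwasawaAlgebra 2) {s}) 𝔭' ≤
      lengthAt (IwasawaAlgebra 2) Y.X (PrimeSpectrum.comap (IwasawaAlgebra.invol 2).toRingHom 𝔭') := by
  haveI := T.finite_H2
  exact lengthAt_quotient_span_le_of_cycTransportSocket T.D T.hreg T.isTorsion_H2 T.thm57Regular T.section151 hγ T.socket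

end Socket

end Summit.BirchSwinnertonDyer.BirchSwinnertonDyer.Theorems.KatoDescent

end
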